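import Summits.HodgeConjecture.HodgeConjecture.Theorems.NikulinTwinTransportRealMultiplicationAnchorOfAlgebraic
import Literature.AlgebraicGeometry.HodgeTheory.CorrespondenceActionOfGraph
import Literature.AlgebraicGeometry.HodgeTheory.HodgeTypeExteriorProduct

/-!
# Route NikulinTwinTransport · crux `TwinTransportRMPicardTwo` (stmt-HodgeConjecture-15067) —
# the order-`8` automorphism species at ANY Picard rank

Generalisation of `NikulinTwinTransportTwinTransportRMPicardTwoSwapAnchor` (Picard rank `2`,
rulings swapped): for a projective K3 surface `S` with inverse automorphisms `φ, ψ` (`φ^*` trivial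
on `H⁴`), ANY finite family `D : Fin r → NS` of rational algebraic classes spanning
`NS := algebraicClasses S 1` with an invertible Gram matrix (a rational two-sided inverse `Ginv`
is part of the data: `Σⱼ Ginv i j (Dⱼ.Dₖ) = δ_{ik} p₁`), `φ^*, ψ^*` preserving `NS`, and `(φ^*)⁴ = -1`
on `NS^⊥`, the endomorphism `e := (φ^* + ψ^*) ∘ (1 - π_NS)` with
`π_NS x = ± Σᵢ (Σⱼ Ginv i j (x.Dⱼ)) Dᵢ` is rational, type-preserving, cup-self-adjoint, kills `NS`,
satisfies `e (e x) = 2x` on `NS^⊥` and is ALGEBRAIC (graph classes of `φ, ψ` and divisor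
correspondences `x ↦ (x.Dⱼ)·(φ^* + ψ^*)Dᵢ`). Hence (file `…AutAnchorConclusion`) the conclusion of
`TwinTwistorTransport` / `TwinTransportRMPicardTwo` (an algebraic anchor into `S`) holds at every
member of the `ζ₈` double-quadric family — Picard rank `2, 6, 10, …`, `rank T = 20, 16, 12, …` — not
only at the rank-`2` ones: instances of the transport crux's anchor off the Nikulin locus
(`rank T ≥ 16 > 14`) at several Picard ranks.

Prover seat prover-…-NikulinTwinTransport-1. References: [VanGeemenSchuett2023] arXiv:2310.05196
§2.3, §4.8; [Fulton1998] §16.1 Prop. 16.1.1–16.1.2; [Huybrechts2016K3] Ch. 3 §3, Ch. 15 §1.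
-/

noncomputable section

namespace Summit.HodgeConjecture.HodgeConjecture.Theorems.NikulinTwinTransport

open scoped Manifold
open CategoryTheory MonoidalCategory SemiCartesianMonoidalCategory
open Literature.AlgebraicGeometry.Motives Literature.AlgebraicGeometry.HodgeTheory
open Literature.AlgebraicGeometry.Surfaces Literature.Geometry.Kaehler
open Literature.AlgebraicTopology.SingularHomology

variable {S : SchemeOver ℂ}

/-- **Order-`8` automorphism species, any Picard rank.** Let `S` be a projective K3 surface with
automorphisms `φ, ψ` inverse to each other, `φ^*` trivial on `H⁴`; `D : Fin r → NS` rational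
algebraic classes spanning `NS = algebraicClasses S 1`, with a rational matrix `Ginv` inverting
their Gram matrix on both sides against an integral generator `p₁` of `H⁴`
(`Σⱼ Ginv i j • (Dⱼ ∪ Dₖ) = δ_{ik} • p₁`, `Σᵢ Ginv i j • (Dₖ ∪ Dᵢ) = δ_{jk} • p₁`); `φ^* Dᵢ, ψ^* Dᵢ ∈ NS`;
and `(φ^*)⁴ = -1` on `NS^⊥`. Then some endomorphism `e` of `H²(S(ℂ); ℂ)` is rational,
type-preserving, cup-self-adjoint, kills `NS`, has `e (e x) = 2x` and `e x = φ^*x + ψ^*x` for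
`x ⊥ NS`, and is `[γ]_*` for an algebraic `γ` on `S × S` — namely
`e = (φ^* + ψ^*) ∘ (1 - π_NS)`, `π_NS x = ±Σᵢ (Σⱼ Ginv i j (x.Dⱼ)) Dᵢ` (graph classes and divisor
correspondences). [cite: VanGeemenSchuett2023, §2.3 and §4.8]
[cite: Fulton1998, §16.1 Prop. 16.1.1–16.1.2] -/
theorem autRealMultiplication_spec
    (hmark : Huybrechts_K3_marking_exists) (hHT : Huybrechts_K3_hodgeTypes_H2)
    (hG : Grothendieck1969_supportedClasses_le_hodgeConiveau)
    (μ : OrientationFamily) (hμ : μ.HasPoincareDuality) (hS : IsK3Surface S)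
    (φ ψ : S ⟶ S) (hφψ : φ ≫ ψ = 𝟙 S) (hψφ : ψ ≫ φ = 𝟙 S)
    (hφtop : ∀ z : complexBetti S (2 * 2), complexBetti.map φ (2 * 2) z = z)
    (p₁ : complexBetti S (2 * 2))
    (hp₁ : IsIntegralClass p₁ ∧ ∀ q : complexBetti S (2 * 2), IsIntegralClass q → ∃ n : ℤ, q = n • p₁)
    {r : ℕ} (D : Fin r → complexBetti S (2 * 1)) (hD : ∀ i, D i ∈ algebraicClasses S 1)
    (hDr : ∀ i, IsRationalClass (D i)) (Ginv : Matrix (Fin r) (Fin r) ℚ)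
    (hG₁ : ∀ i k, ∑ j, ((Ginv i j : ℚ) : ℂ) • cupProduct (rfl : 2 * 1 + 2 * 1 = 2 * 2) (D j) (D k) =
      (if i = k then (1 : ℂ) else 0) • p₁)
    (hG₂ : ∀ j k, ∑ i, ((Ginv i j : ℚ) : ℂ) • cupProduct (rfl : 2 * 1 + 2 * 1 = 2 * 2) (D k) (D i) =
      (if j = k then (1 : ℂ) else 0) • p₁)
    (hspan : ∀ d ∈ algebraicClasses S 1, ∃ c : Fin r → ℂ, d = ∑ i, c i • D i)
    (hφN : ∀ i, complexBetti.map φ (2 * 1) (D i) ∈ algebraicClasses S 1)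
    (hψN : ∀ i, complexBetti.map ψ (2 * 1) (D i) ∈ algebraicClasses S 1)
    (hT : ∀ x : complexBetti S (2 * 1),
      (∀ d ∈ algebraicClasses S 1, cupProduct (rfl : 2 * 1 + 2 * 1 = 2 * 2) x d = 0) →
        complexBetti.map φ (2 * 1) (complexBetti.map φ (2 * 1)
          (complexBetti.map φ (2 * 1) (complexBetti.map φ (2 * 1) x))) = -x) :
    ∃ e : complexBetti S (2 * 1) →ₗ[ℂ] complexBetti S (2 * 1),
      (∀ x, IsRationalClass x → IsRationalClass (e x)) ∧
      (∀ (i j : ℕ) x, IsOfHodgeType 2 S (2 * 1) i j x → IsOfHodgeType 2 S (2 * 1) i j (e x)) ∧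
      (∀ x y : complexBetti S (2 * 1), cupProduct (rfl : 2 * 1 + 2 * 1 = 2 * 2) (e x) y =
        cupProduct (rfl : 2 * 1 + 2 * 1 = 2 * 2) x (e y)) ∧
      (∀ d ∈ algebraicClasses S 1, e d = 0) ∧
      (∀ x : complexBetti S (2 * 1),
        (∀ d ∈ algebraicClasses S 1, cupProduct (rfl : 2 * 1 + 2 * 1 = 2 * 2) x d = 0) →
          e (e x) = (2 : ℂ) • x) ∧
      (∃ γ ∈ algebraicClasses (S ⊗ S) 2, ∀ x : complexBetti S (2 * 1),
        e x = complexGysin μ (IsSmoothProjective.tensor_holds hS.1 hS.1) hS.1 (fst S S)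
          (rfl : 2 * 1 + 2 * 2 + 2 * 2 = 2 * 1 + 2 * (2 + 2))
          (cupProduct (rfl : 2 * 1 + 2 * 2 = 2 * 1 + 2 * 2)
            (complexBetti.map (snd S S) (2 * 1) x) γ)) ∧
      (∀ x : complexBetti S (2 * 1),
        (∀ d ∈ algebraicClasses S 1, cupProduct (rfl : 2 * 1 + 2 * 1 = 2 * 2) x d = 0) →
          e x = complexBetti.map φ (2 * 1) x + complexBetti.map ψ (2 * 1) x) := by
  classical
  set N := algebraicClasses S 1 with hNdef
  -- the pull-backs, inverse to each other
  set Φ : complexBetti S (2 * 1) →ₗ[ℂ] complexBetti S (2 * 1) := (complexBetti.map φ (2 * 1)).hom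
    with hΦdef
  set Ψ : complexBetti S (2 * 1) →ₗ[ℂ] complexBetti S (2 * 1) := (complexBetti.map ψ (2 * 1)).hom
    with hΨdef
  have hΦapp : ∀ x, Φ x = complexBetti.map φ (2 * 1) x := fun x => rfl
  have hΨapp : ∀ x, Ψ x = complexBetti.map ψ (2 * 1) x := fun x => rfl
  have hΦΨ : ∀ x, Φ (Ψ x) = x := fun x => by
    rw [hΦapp, hΨapp, ← ModuleCat.comp_apply, ← complexBetti.map_comp, hφψ, complexBetti.map_id,
      ModuleCat.id_apply]
  have hΨΦ : ∀ x, Ψ (Φ x) = x := fun x => by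
    rw [hΦapp, hΨapp, ← ModuleCat.comp_apply, ← complexBetti.map_comp, hψφ, complexBetti.map_id,
      ModuleCat.id_apply]
  have hT' : ∀ x : complexBetti S (2 * 1), (∀ d ∈ N, cupProduct (rfl : 2 * 1 + 2 * 1 = 2 * 2) x d = 0) →
      Φ (Φ (Φ (Φ x))) = -x := hT
  -- a marking: the cup form `B`, `x ∪ y = B x y • p₀`, `p₀ = ε p₁`
  obtain ⟨η, p₀, x₀, hp₀, ⟨hp₀int, hp₀gen, hηint, hηcup, h20, -⟩, ⟨hx00, hxpos, -⟩⟩ := hmark S hS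
  have hσ0 : η.symm x₀ ≠ 0 := fun h0 =>
    ne_zero_of_star_self_re_pos hxpos (by simpa using congrArg η h0)
  obtain ⟨h1, h2, h3⟩ := hHT S hS (η.symm x₀) h20 hσ0
  rw [conjClass_marking_symm η hηint] at h2 h3
  obtain ⟨A⟩ := hS.nonempty_hodgeModel
  have hp₁0 : p₁ ≠ 0 := generator_ne_zero hS hp₁.2
  obtain ⟨ε, hε, hε1, hpε⟩ : ∃ ε : ℚ, (ε = 1 ∨ ε = -1) ∧ (ε : ℂ) * ε = 1 ∧ p₁ = (ε : ℂ) • p₀ := by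
    rcases eq_or_eq_neg_of_zsmul hp₁0 (hp₀gen p₁ hp₁.1) (hp₁.2 p₀ hp₀int) with h | h
    · exact ⟨1, Or.inl rfl, by norm_num, by rw [h, Rat.cast_one, one_smul]⟩
    · exact ⟨-1, Or.inr rfl, by norm_num, by rw [h, Rat.cast_neg, Rat.cast_one, neg_one_smul, neg_neg]⟩
  set B : LinearMap.BilinForm ℂ (complexBetti S (2 * 1)) :=
    k3FormC.compl₁₂ η.toLinearMap η.toLinearMap with hBdef
  have hB : ∀ x y, B x y = k3Form (η x) (η y) := fun x y => by
    simp only [hBdef, LinearMap.compl₁₂_apply, LinearEquiv.coe_coe, k3FormC_apply]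
  have hcupB : ∀ x y, cupProduct (rfl : 2 * 1 + 2 * 1 = 2 * 2) x y = B x y • p₀ := fun x y => by
    rw [hB, hηcup]
  have hBsymm : ∀ x y, B x y = B y x := fun x y => by rw [hB, hB, k3Form_comm]
  have hsmul : ∀ {c c' : ℂ}, c • p₀ = c' • p₀ → c = c' := fun h => smul_left_injective ℂ hp₀ h
  have hcup0 : ∀ {x y}, cupProduct (rfl : 2 * 1 + 2 * 1 = 2 * 2) x y = 0 ↔ B x y = 0 := by
    intro x y
    rw [hcupB, smul_eq_zero, or_iff_left hp₀]
  -- the Gram identities in terms of `B`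
  have hGB₁ : ∀ i k, ∑ j, ((Ginv i j : ℚ) : ℂ) * B (D j) (D k) = ε * if i = k then 1 else 0 := by
    intro i k
    apply hsmul
    rw [Finset.sum_smul, mul_comm ((ε : ℚ) : ℂ) _, mul_smul, ← hpε, ← hG₁ i k]
    refine Finset.sum_congr rfl fun j _ => ?_
    rw [hcupB, smul_smul]
  have hGB₂ : ∀ j k, ∑ i, ((Ginv i j : ℚ) : ℂ) * B (D i) (D k) = ε * if j = k then 1 else 0 := by
    intro j k
    apply hsmul
    rw [Finset.sum_smul, mul_comm ((ε : ℚ) : ℂ) _, mul_smul, ← hpε, ← hG₂ j k]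
    refine Finset.sum_congr rfl fun i _ => ?_
    rw [hcupB, smul_smul, hBsymm]
  -- `Φ` is an isometry, hence so is `Ψ`
  have hiso : ∀ x y, B (Φ x) (Φ y) = B x y := by
    intro x y
    apply hsmul
    rw [← hcupB, ← hcupB, hΦapp, hΦapp, ← cupProduct_map]
    exact hφtop _
  have hisoΨ : ∀ x y, B (Ψ x) y = B x (Φ y) := fun x y => by rw [← hiso (Ψ x) y, hΦΨ]
  have hisoΦ : ∀ x y, B (Φ x) y = B x (Ψ y) := fun x y => by
    conv_lhs => rw [← hΦΨ y]
    rw [hiso]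
  -- orthogonality to `N`
  have horthN : ∀ x, (∀ d ∈ N, cupProduct (rfl : 2 * 1 + 2 * 1 = 2 * 2) x d = 0) ↔ ∀ k, B x (D k) = 0 := by
    intro x
    refine ⟨fun h k => hcup0.1 (h _ (hD k)), fun h d hd => ?_⟩
    obtain ⟨c, rfl⟩ := hspan d hd
    rw [hcup0, map_sum]
    exact Finset.sum_eq_zero fun k _ => by rw [map_smul, h k, smul_zero]
  have hBN : ∀ x, (∀ k, B x (D k) = 0) → ∀ n ∈ N, B x n = 0 := by
    intro x hx n hn
    obtain ⟨c, rfl⟩ := hspan n hn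
    rw [map_sum]
    exact Finset.sum_eq_zero fun k _ => by rw [map_smul, hx k, smul_zero]
  -- the projector `πN x = ε Σᵢ (Σⱼ Ginv i j B(x, Dⱼ)) Dᵢ`
  set L : complexBetti S (2 * 1) →ₗ[ℂ] complexBetti S (2 * 1) :=
    ∑ i, (∑ j, ((Ginv i j : ℚ) : ℂ) • B.flip (D j)).smulRight (D i) with hLdef
  have hL : ∀ x, L x = ∑ i, (∑ j, ((Ginv i j : ℚ) : ℂ) * B x (D j)) • D i := fun x => by
    simp only [hLdef, LinearMap.sum_apply, LinearMap.smulRight_apply, LinearMap.smul_apply,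
      LinearMap.BilinForm.flip_apply, smul_eq_mul]
  set πN : complexBetti S (2 * 1) →ₗ[ℂ] complexBetti S (2 * 1) := (ε : ℂ) • L with hπNdef
  have hπN : ∀ x, πN x = (ε : ℂ) • ∑ i, (∑ j, ((Ginv i j : ℚ) : ℂ) * B x (D j)) • D i := fun x => by
    rw [hπNdef, LinearMap.smul_apply, hL]
  -- (P1) `πN` fixes the `Dₖ`, hence `N`
  have hπND : ∀ k, πN (D k) = D k := by
    intro k
    rw [hπN]
    have h : ∀ i, (∑ j, ((Ginv i j : ℚ) : ℂ) * B (D k) (D j)) = ε * if i = k then 1 else 0 := by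
      intro i
      rw [← hGB₁ i k]
      exact Finset.sum_congr rfl fun j _ => by rw [hBsymm]
    simp_rw [h]
    rw [Finset.smul_sum]
    simp_rw [smul_smul, ← mul_assoc, hε1, one_mul, ite_smul, one_smul, zero_smul]
    rw [Finset.sum_ite_eq' Finset.univ k D, if_pos (Finset.mem_univ k)]
  have hπNN : ∀ n ∈ N, πN n = n := by
    intro n hn
    obtain ⟨c, rfl⟩ := hspan n hn
    rw [map_sum]
    exact Finset.sum_congr rfl fun k _ => by rw [map_smul, hπND]
  -- (P2) `x - πN x ⊥ N`
  have hπNorth : ∀ x k, B (πN x) (D k) = B x (D k) := by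
    intro x k
    rw [hπN, map_smul, LinearMap.smul_apply, map_sum, LinearMap.sum_apply]
    have h : ∀ i, B ((∑ j, ((Ginv i j : ℚ) : ℂ) * B x (D j)) • D i) (D k) =
        ∑ j, ((Ginv i j : ℚ) : ℂ) * B (D i) (D k) * B x (D j) := by
      intro i
      rw [map_smul, LinearMap.smul_apply, smul_eq_mul, Finset.sum_mul]
      exact Finset.sum_congr rfl fun j _ => by ring
    simp_rw [h]
    rw [Finset.sum_comm]
    have h' : ∀ j, ∑ i, ((Ginv i j : ℚ) : ℂ) * B (D i) (D k) * B x (D j) =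
        (ε * if j = k then 1 else 0) * B x (D j) := by
      intro j
      rw [← Finset.sum_mul, hGB₂ j k]
    simp_rw [h']
    simp_rw [mul_assoc, ite_mul, one_mul, zero_mul, ← Finset.mul_sum, smul_eq_mul, ← mul_assoc, hε1,
      one_mul]
    rw [Finset.sum_ite_eq' Finset.univ k (fun j => B x (D j)), if_pos (Finset.mem_univ k)]
  have hπNorth' : ∀ x n, n ∈ N → B (πN x) n = B x n := by
    intro x n hn
    obtain ⟨c, rfl⟩ := hspan n hn
    rw [map_sum, map_sum]
    exact Finset.sum_congr rfl fun k _ => by rw [map_smul, map_smul, hπNorth]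
  -- (P3) `πN x ∈ N`; (P4) `x ⊥ N → πN x = 0`; `N ∩ N^⊥ = 0`
  have hπNmem : ∀ x, πN x ∈ N := fun x => by
    rw [hπN]
    exact N.smul_mem _ (N.sum_mem fun i _ => N.smul_mem _ (hD i))
  have hπN0 : ∀ x, (∀ k, B x (D k) = 0) → πN x = 0 := fun x hx => by
    rw [hπN]
    simp_rw [hx, mul_zero, Finset.sum_const_zero, zero_smul, Finset.sum_const_zero, smul_zero]
  have hNN : ∀ n ∈ N, (∀ k, B n (D k) = 0) → n = 0 := fun n hn h0 => by
    rw [← hπNN n hn, hπN0 n h0]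
  -- `πN` is `B`-self-adjoint and commutes with `Ψ₀ = Φ + Ψ`
  have hπNadj : ∀ x y, B (πN x) y = B x (πN y) := by
    intro x y
    have h1 : B (πN x) y = B (πN x) (πN y) := by
      have h := hπNorth' y (πN x) (hπNmem x)
      rw [hBsymm, ← h, hBsymm]
    have h2 : B x (πN y) = B (πN x) (πN y) := by
      rw [← hπNorth' x (πN y) (hπNmem y)]
    rw [h1, h2]
  set Ψ₀ : complexBetti S (2 * 1) →ₗ[ℂ] complexBetti S (2 * 1) := Φ + Ψ with hΨ₀def
  have hΨ₀ : ∀ x, Ψ₀ x = Φ x + Ψ x := fun x => rfl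
  have hΦN : ∀ n ∈ N, Φ n ∈ N := by
    intro n hn
    obtain ⟨c, rfl⟩ := hspan n hn
    rw [map_sum]
    exact N.sum_mem fun i _ => by rw [map_smul]; exact N.smul_mem _ (hφN i)
  have hΨN : ∀ n ∈ N, Ψ n ∈ N := by
    intro n hn
    obtain ⟨c, rfl⟩ := hspan n hn
    rw [map_sum]
    exact N.sum_mem fun i _ => by rw [map_smul]; exact N.smul_mem _ (hψN i)
  have hΨ₀N : ∀ n ∈ N, Ψ₀ n ∈ N := fun n hn => N.add_mem (hΦN n hn) (hΨN n hn)
  have hΨ₀adj : ∀ x y, B (Ψ₀ x) y = B x (Ψ₀ y) := fun x y => by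
    rw [hΨ₀, hΨ₀, map_add, LinearMap.add_apply, map_add, hisoΦ, hisoΨ, add_comm]
  have hΦorth : ∀ x, (∀ k, B x (D k) = 0) → ∀ k, B (Φ x) (D k) = 0 := fun x hx k => by
    rw [hisoΦ]; exact hBN x hx _ (hΨN _ (hD k))
  have hΨorth : ∀ x, (∀ k, B x (D k) = 0) → ∀ k, B (Ψ x) (D k) = 0 := fun x hx k => by
    rw [hisoΨ]; exact hBN x hx _ (hΦN _ (hD k))
  have hcomm : ∀ y, πN (Ψ₀ y) = Ψ₀ (πN y) := by
    intro y
    rw [← sub_eq_zero]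
    refine hNN _ (N.sub_mem (hπNmem _) (hΨ₀N _ (hπNmem y))) fun k => ?_
    rw [map_sub, LinearMap.sub_apply, hπNorth, hΨ₀adj, hΨ₀adj, hπNorth' y _ (hΨ₀N _ (hD k)),
      sub_self]
  -- the endomorphism `e = Ψ₀ ∘ (1 - πN)`
  set e : complexBetti S (2 * 1) →ₗ[ℂ] complexBetti S (2 * 1) := Ψ₀ - Ψ₀ ∘ₗ πN with hedef
  have he : ∀ x, e x = Ψ₀ x - Ψ₀ (πN x) := fun x => rfl
  have heT : ∀ x, (∀ k, B x (D k) = 0) → e x = Φ x + Ψ x := fun x hx => by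
    rw [he, hπN0 x hx, map_zero, sub_zero, hΨ₀]
  have heN : ∀ d ∈ N, e d = 0 := fun d hd => by rw [he, hπNN d hd, sub_self]
  refine ⟨e, ?_, ?_, ?_, heN, ?_, ?_, fun x hx => heT x ((horthN x).1 hx)⟩
  · -- (R) rationality
    intro x hx
    obtain ⟨w, hw⟩ := (isRationalClass_iff_of_marking hS η hηint x).1 hx
    choose u hu using fun i => (isRationalClass_iff_of_marking hS η hηint (D i)).1 (hDr i)
    have hBr : ∀ j, B x (D j) = ((k3FormRat w (u j) : ℚ) : ℂ) := fun j => by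
      rw [hB, hw, hu, k3Form_ratCast]
    have hπx : πN x = ∑ i, ((ε * ∑ j, Ginv i j * k3FormRat w (u j) : ℚ) : ℂ) • D i := by
      rw [hπN, Finset.smul_sum]
      refine Finset.sum_congr rfl fun i _ => ?_
      rw [smul_smul]
      congr 1
      push_cast
      congr 1
      exact Finset.sum_congr rfl fun j _ => by rw [hBr]
    have hπr : IsRationalClass (πN x) := by
      rw [hπx]
      have h0 : IsRationalClass (0 : complexBetti S (2 * 1)) := by simpa using hx.smul 0
      have : ∀ s : Finset (Fin r), IsRationalClass
          (∑ i ∈ s, ((ε * ∑ j, Ginv i j * k3FormRat w (u j) : ℚ) : ℂ) • D i) := by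
        intro s
        induction s using Finset.induction_on with
        | empty => rwa [Finset.sum_empty]
        | insert a s ha ih =>
          rw [Finset.sum_insert ha]
          exact ((hDr a).smul _).add ih
      exact this _
    have hΨ₀r : ∀ y, IsRationalClass y → IsRationalClass (Ψ₀ y) :=
      fun y hy => (hy.map _).add (hy.map _)
    have hneg : ∀ c : complexBetti S (2 * 1), -c = ((-1 : ℚ) : ℂ) • c := fun c => by
      rw [Rat.cast_neg, Rat.cast_one, neg_one_smul]
    rw [he, sub_eq_add_neg, hneg]
    exact (hΨ₀r x hx).add ((hΨ₀r _ hπr).smul _)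
  · -- (H) Hodge types
    have hN11 : ∀ d ∈ N, IsOfHodgeType 2 S (2 * 1) 1 1 d :=
      fun d hd => isOfHodgeType_oneOne_of_mem_algebraicClasses hG hS hd
    have hDσ : ∀ k, B (η.symm x₀) (D k) = 0 := fun k => by
      rw [hBsymm]; exact hcup0.1 ((h3 (D k)).1 (hN11 _ (hD k))).1
    have hDσ' : ∀ k, B (η.symm (star x₀)) (D k) = 0 := fun k => by
      rw [hBsymm]; exact hcup0.1 ((h3 (D k)).1 (hN11 _ (hD k))).2
    have hΨ₀type : ∀ (i j : ℕ) y, IsOfHodgeType 2 S (2 * 1) i j y →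
        IsOfHodgeType 2 S (2 * 1) i j (Ψ₀ y) := fun i j y hy =>
      (IsOfHodgeType.map_of_isSmoothProjective hy hS.1 hS.1 φ).add hS.1
        (IsOfHodgeType.map_of_isSmoothProjective hy hS.1 hS.1 ψ)
    intro i j y hy
    by_cases hij : i + j = 2 * 1
    · obtain ⟨rfl, rfl⟩ | ⟨rfl, rfl⟩ | ⟨rfl, rfl⟩ :
          (i = 2 ∧ j = 0) ∨ (i = 0 ∧ j = 2) ∨ (i = 1 ∧ j = 1) := by omega
      · obtain ⟨t, ht⟩ := (h1 y).1 hy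
        have hy0 : ∀ k, B y (D k) = 0 := fun k => by
          rw [ht, map_smul, LinearMap.smul_apply, hDσ, smul_zero]
        rw [heT y hy0]
        exact hΨ₀type 2 0 y hy
      · obtain ⟨t, ht⟩ := (h2 y).1 hy
        have hy0 : ∀ k, B y (D k) = 0 := fun k => by
          rw [ht, map_smul, LinearMap.smul_apply, hDσ', smul_zero]
        rw [heT y hy0]
        exact hΨ₀type 0 2 y hy
      · rw [he]
        exact (hΨ₀type 1 1 y hy).sub hS.1 (hΨ₀type 1 1 _ (hN11 _ (hπNmem y)))
    · obtain rfl := isOfHodgeType_eq_zero_of_add_ne hy hij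
      rw [map_zero]
      exact IsOfHodgeType.zero A _ _ _
  · -- (A) self-adjointness
    intro x y
    rw [hcupB, hcupB, he x, he y, map_sub, LinearMap.sub_apply, map_sub, hΨ₀adj x y,
      hΨ₀adj (πN x) y, hπNadj x (Ψ₀ y), hcomm y]
  · -- (T2) `e (e x) = 2x` on `N^⊥`
    intro x hx
    have hx' := (horthN x).1 hx
    have hΦx := hΦorth x hx'
    have hΨx := hΨorth x hx'
    have hΨΨ : Ψ (Ψ x) = -Φ (Φ x) := by
      have h4 := congrArg (fun z => Ψ (Ψ z)) (hT' x hx)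
      simp only [hΨΦ, map_neg] at h4
      rw [h4, neg_neg]
    rw [heT x hx', map_add, heT _ hΦx, heT _ hΨx, hΨΦ, hΦΨ, hΨΨ, two_smul]
    abel
  · -- (G) algebraicity
    have hind : ∀ (χ : S ⟶ S), ∃ γ ∈ algebraicClasses (S ⊗ S) 2, ∀ x : complexBetti S (2 * 1),
        (complexBetti.map χ (2 * 1)).hom x =
          complexGysin μ (IsSmoothProjective.tensor_holds hS.1 hS.1) hS.1 (fst S S)
            (rfl : 2 * 1 + 2 * 2 + 2 * 2 = 2 * 1 + 2 * (2 + 2))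
            (cupProduct (rfl : 2 * 1 + 2 * 2 = 2 * 1 + 2 * 2)
              (complexBetti.map (snd S S) (2 * 1) x) γ) := by
      intro χ
      obtain ⟨γ, hγ, hact⟩ := exists_algebraic_corrAction_eq_of_pushPull hμ hS.1
        (T := (complexBetti.map χ (2 * 1)).hom)
        ⟨S, hS.1, 𝟙 S, χ, 1, by rw [one_smul, complexGysin_id hμ hS.1, LinearMap.id_comp]⟩
      exact ⟨γ, hγ, fun x => by rw [← hact]; rfl⟩
    obtain ⟨c, hc, hκ⟩ := fibreIntegral_of_kunnethTop μ hS.1 hS.1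
      (kunnethSpan_complexBetti hS.1 hS.1 (2 * (2 + 2))) hp₀
    have hdiv : ∀ {a b : complexBetti S (2 * 1)}, a ∈ N → b ∈ N →
        ∃ γ ∈ algebraicClasses (S ⊗ S) 2, ∀ x : complexBetti S (2 * 1),
          ((B.flip a).smulRight b) x =
            complexGysin μ (IsSmoothProjective.tensor_holds hS.1 hS.1) hS.1 (fst S S)
              (rfl : 2 * 1 + 2 * 2 + 2 * 2 = 2 * 1 + 2 * (2 + 2))
              (cupProduct (rfl : 2 * 1 + 2 * 2 = 2 * 1 + 2 * 2)
                (complexBetti.map (snd S S) (2 * 1) x) γ) := by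
      intro a b ha hb
      obtain ⟨γ, hγ, hγeq⟩ := divisorCorrespondence_of_fibreIntegral μ hμ S hS p₀ c hc hκ ha hb
      refine ⟨γ, hγ, fun x => ?_⟩
      rw [LinearMap.smulRight_apply, LinearMap.BilinForm.flip_apply]
      exact (hγeq x _ (hcupB x a)).symm
    -- `Ψ₀ ∘ πN` as a double sum of divisor correspondences
    have hCeq : Ψ₀ ∘ₗ πN = ∑ i, ∑ j, ((ε * Ginv i j : ℚ) : ℂ) • (B.flip (D j)).smulRight (Ψ₀ (D i)) := by
      refine LinearMap.ext fun x => ?_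
      rw [LinearMap.comp_apply, hπN, map_smul, map_sum, LinearMap.sum_apply, Finset.smul_sum]
      refine Finset.sum_congr rfl fun i _ => ?_
      rw [map_smul, LinearMap.sum_apply, Finset.sum_smul, Finset.smul_sum]
      refine Finset.sum_congr rfl fun j _ => ?_
      rw [LinearMap.smul_apply, LinearMap.smulRight_apply, LinearMap.BilinForm.flip_apply, smul_smul,
        smul_smul]
      push_cast
      ring_nf
    have hTS := IsSmoothProjective.tensor_holds hS.1 hS.1
    have hCind := induced_sum hTS hS.1 (rfl : 2 * 1 + 2 * 2 = 2 * 1 + 2 * 2)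
      (rfl : 2 * 1 + 2 * 2 + 2 * 2 = 2 * 1 + 2 * (2 + 2)) Finset.univ
      (fun i => ∑ j, ((ε * Ginv i j : ℚ) : ℂ) • (B.flip (D j)).smulRight (Ψ₀ (D i)))
      (fun i _ => induced_sum hTS hS.1 (rfl : 2 * 1 + 2 * 2 = 2 * 1 + 2 * 2)
        (rfl : 2 * 1 + 2 * 2 + 2 * 2 = 2 * 1 + 2 * (2 + 2)) Finset.univ
        (fun j => ((ε * Ginv i j : ℚ) : ℂ) • (B.flip (D j)).smulRight (Ψ₀ (D i)))
        (fun j _ => induced_smul hTS hS.1 (rfl : 2 * 1 + 2 * 2 = 2 * 1 + 2 * 2)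
          (rfl : 2 * 1 + 2 * 2 + 2 * 2 = 2 * 1 + 2 * (2 + 2)) _
          (hdiv (hD j) (hΨ₀N _ (hD i)))))
    rw [← hCeq] at hCind
    have hΨ₀ind := induced_add hTS hS.1 (rfl : 2 * 1 + 2 * 2 = 2 * 1 + 2 * 2)
      (rfl : 2 * 1 + 2 * 2 + 2 * 2 = 2 * 1 + 2 * (2 + 2)) (hind φ) (hind ψ)
    have h := induced_sub hTS hS.1 (rfl : 2 * 1 + 2 * 2 = 2 * 1 + 2 * 2)
      (rfl : 2 * 1 + 2 * 2 + 2 * 2 = 2 * 1 + 2 * (2 + 2)) hΨ₀ind hCind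
    rw [← hΨ₀def, ← hedef] at h
    exact h

end Summit.HodgeConjecture.HodgeConjecture.Theorems.NikulinTwinTransport

end
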